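import Summits.CriticalPhenomena.CardyFormulaZ2.Theses.CardyBoundaryCoulombGas
import Literature.Probability.LatticeModels.CollarLegModel
import Literature.Probability.LatticeModels.DirichletGreenFunction

/-!
# Stub `stub_rigidity_of_local_laws` of line `rainbow-monomials-in-excursion-kernels` — Part 1:
# abstract bookkeeping (telescoping and the one-domain transport estimate)

Crux `BoundaryDefectGaussianR` (stmt-CriticalPhenomena-14132), skeleton
`Cruxes/BoundaryDefectGaussianR/Lines/rainbow-monomials-in-excursion-kernels.lean`, Stub 3
(`stub_rigidity_of_local_laws : POINT_TRANSPORT → CLUSTER_LOCALITY → RIGIDITY`).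

Finding of this worker (see Part 3): RIGIDITY does not follow from the two local laws alone — both
laws ASSUME positivity of the rainbow probabilities they compare, so neither the realisability
conjunct `∀ᶠ n, 0 < P_n` of RIGIDITY nor the positivity of the intermediate configurations of the
transport is supplied; and the existence of ADMISSIBLE TRANSPORT PATHS in the lattice
approximations (the combinatorial/geometric heart: boundary walk of `V_n`, corner crossing,
clustering on the lowest edge, orientation) is a separate statement. Parts 1–2 prove the
analytic bookkeeping ABSTRACTLY — admissibility `Adm`, probability `P` and the functional `F` are
arbitrary functions of (lattice domain, configuration); Part 3 instantiates them with
`CollarLegModel.LegInsertionData.IsAdmissible`, `‖Zins‖/‖Z‖` and `log P − Λ` and proves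
`s3_rigidityOfTransportFamily`, Part 4 the skeleton-shaped
`s3_rigidityOfTransport : TRANSPORT → REAL → POINT_TRANSPORT → CLUSTER_LOCALITY → RIGIDITY` with the
skeleton's texts verbatim.

This file: `s3_telescope` (telescoping along a tagged path) and `s3_oneDomain` (in ONE domain:
unit-slide law at flatness scale `ρ/4` + `ρ`-jump law + realisability + transport paths ⇒
eventually, uniformly over the admissible cluster slots, the cluster configuration is admissible,
positive, and `|F(p_n) − F(cluster)| ≤ ε`; the order of choices is `ε → ε' = ε/(2N+2) → ρ(r, ε') →`
slides at scale `ρ/4`).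
-/

noncomputable section

open Filter Topology

namespace Summit.CriticalPhenomena.CardyFormulaZ2.Cruxes.BoundaryDefectGaussianR.RainbowMonomialsInExcursionKernels

/-- **Telescoping along a transport path.** If consecutive values of `F` along `q 0, …, q T` differ
by at most `e₁` at the steps tagged `true` (unit slides) and by at most `e₂` at the steps tagged
`false` (jumps), then `|F (q T) - F (q 0)| ≤ T·e₁ + #{jumps}·e₂`. [folklore] -/
theorem s3_telescope :
    ∀ {X : Type} (F : X → ℝ) (q : ℕ → X) (σ : ℕ → Bool) (e₁ e₂ : ℝ), (0 ≤ e₁) → ∀ T : ℕ, (∀ t, t < T → |F (q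
    (t + 1)) - F (q t)| ≤ if σ t then e₁ else e₂) → |F (q T) - F (q 0)| ≤ (T : ℝ) * e₁ + (((Finset.range
    T).filter (fun t ↦ σ t = false)).card : ℝ) * e₂ := by
  intro X F q σ e₁ e₂ h₁ T
  induction T with
  | zero =>
    intro _
    simp
  | succ T ih =>
    intro h
    have hT := ih fun t ht ↦ h t (Nat.lt_succ_of_lt ht)
    have hlast := h T (Nat.lt_succ_self T)
    have tri : |F (q (T + 1)) - F (q 0)| ≤ |F (q (T + 1)) - F (q T)| + |F (q T) - F (q 0)| :=
      abs_sub_le _ _ _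
    rw [Finset.range_add_one, Finset.filter_insert]
    have hnot : T ∉ (Finset.range T).filter (fun t ↦ σ t = false) := fun hm ↦
      Finset.notMem_range_self (Finset.mem_filter.1 hm).1
    cases hσ : σ T with
    | true =>
      simp only [hσ, if_true] at hlast
      simp only [Bool.true_eq_false, if_false]
      push_cast
      nlinarith [tri, hlast, hT]
    | false =>
      simp only [hσ, Bool.false_eq_true, if_false] at hlast
      simp only [if_true]
      rw [Finset.card_insert_of_notMem hnot]
      push_cast
      nlinarith [tri, hlast, hT]

/-- **One-domain transport estimate (abstract bookkeeping).** For abstract admissibility `Adm`,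
probability `P` and functional `F` on lattice configurations: the unit-slide law (`hPTa`), the
`ρ`-jump law (`hPTb`), realisability (`hR`) and the existence of admissible transport paths into the
cluster slots `((a n).1 + x i, (a n).2)` (`hT`) give, for every `ε` and every admissible scale
`r ≤ r₀`, eventually: the cluster configuration is admissible, both it and `p n` have positive
probability, and `|F (p n) - F (cluster)| ≤ ε` (telescoping: `≤ N/δ` slides at `ε'δ` each and `≤ N`
jumps at `ε'` each). [folklore] -/
theorem s3_oneDomain :
    ∀ {k : ℕ} (Adm : Finset (ℤ × ℤ) → (Fin k → ℤ × ℤ) → Prop) (P F : Finset (ℤ × ℤ) → (Fin k → ℤ × ℤ) → ℝ)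
    (δ : ℕ → ℝ), (∀ n, 0 < δ n) → ∀ (V : ℕ → Finset (ℤ × ℤ)) (p : ℕ → Fin k → ℤ × ℤ) (a : ℕ → ℤ × ℤ) (s₀ r₀
    : ℝ) (N : ℕ), (∀ (r ε : ℝ), 0 < r → 0 < ε → ∀ᶠ n in Filter.atTop, ∀ (p : Fin k → ℤ × ℤ) (i : Fin k) (τ :
    ℤ × ℤ), (τ = (1, 0) ∨ τ = (-1, 0) ∨ τ = (0, 1) ∨ τ = (0, -1)) → Function.Injective p →
    Function.Injective (Function.update p i (p i + τ)) → Adm (V n) p → Adm (V n) (Function.update p i (p i +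
    τ)) → 0 < P (V n) p → 0 < P (V n) (Function.update p i (p i + τ)) → (∀ i', ∃ d : ℤ × ℤ, (d = (1, 0) ∨ d
    = (-1, 0) ∨ d = (0, 1) ∨ d = (0, -1)) ∧ ∀ v : ℤ × ℤ, (((((v).1 - (p i').1) ^ 2 + ((v).2 - (p i').2) ^ 2
    : ℤ) : ℝ)) ≤ (r / δ n) ^ 2 → (v ∈ V n ↔ 0 ≤ (v.1 - (p i').1) * d.1 + (v.2 - (p i').2) * d.2)) → (∀ i₁ i₂
    : Fin k, i₁ ≠ i₂ → (r / δ n) ^ 2 ≤ ((((((p) i₁).1 - ((p) i₂).1) ^ 2 + (((p) i₁).2 - ((p) i₂).2) ^ 2 : ℤ)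
    : ℝ))) → |F (V n) (Function.update p i (p i + τ)) - F (V n) p| ≤ ε * δ n) → (∀ (r ε : ℝ), 0 < r → 0 < ε
    → ∃ ρ : ℝ, 0 < ρ ∧ ρ ≤ r ∧ ∀ᶠ n in Filter.atTop, ∀ (p : Fin k → ℤ × ℤ) (i : Fin k) (q : ℤ × ℤ),
    Function.Injective p → Function.Injective (Function.update p i q) → Adm (V n) p → Adm (V n)
    (Function.update p i q) → 0 < P (V n) p → 0 < P (V n) (Function.update p i q) → (∀ i', i' ≠ i → ∃ d : ℤ
    × ℤ, (d = (1, 0) ∨ d = (-1, 0) ∨ d = (0, 1) ∨ d = (0, -1)) ∧ ∀ v : ℤ × ℤ, (((((v).1 - (p i').1) ^ 2 +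
    ((v).2 - (p i').2) ^ 2 : ℤ) : ℝ)) ≤ (r / δ n) ^ 2 → (v ∈ V n ↔ 0 ≤ (v.1 - (p i').1) * d.1 + (v.2 - (p
    i').2) * d.2)) → (∃ d : ℤ × ℤ, (d = (1, 0) ∨ d = (-1, 0) ∨ d = (0, 1) ∨ d = (0, -1)) ∧ ∀ v : ℤ × ℤ,
    (((((v).1 - (p i).1) ^ 2 + ((v).2 - (p i).2) ^ 2 : ℤ) : ℝ)) ≤ (ρ / 4 / δ n) ^ 2 → (v ∈ V n ↔ 0 ≤ (v.1 -
    (p i).1) * d.1 + (v.2 - (p i).2) * d.2)) → (∃ d : ℤ × ℤ, (d = (1, 0) ∨ d = (-1, 0) ∨ d = (0, 1) ∨ d =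
    (0, -1)) ∧ ∀ v : ℤ × ℤ, (((((v).1 - (q).1) ^ 2 + ((v).2 - (q).2) ^ 2 : ℤ) : ℝ)) ≤ (ρ / 4 / δ n) ^ 2 → (v
    ∈ V n ↔ 0 ≤ (v.1 - (q).1) * d.1 + (v.2 - (q).2) * d.2)) → (∀ i₁ i₂ : Fin k, i₁ ≠ i₂ → (r / δ n) ^ 2 ≤
    ((((((p) i₁).1 - ((p) i₂).1) ^ 2 + (((p) i₁).2 - ((p) i₂).2) ^ 2 : ℤ) : ℝ))) → (∀ i₁ i₂ : Fin k, i₁ ≠ i₂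
    → (r / δ n) ^ 2 ≤ (((((((Function.update p i q)) i₁).1 - (((Function.update p i q)) i₂).1) ^ 2 +
    ((((Function.update p i q)) i₁).2 - (((Function.update p i q)) i₂).2) ^ 2 : ℤ) : ℝ))) → (((((q).1 - (p
    i).1) ^ 2 + ((q).2 - (p i).2) ^ 2 : ℤ) : ℝ)) ≤ (ρ / δ n) ^ 2 → |F (V n) (Function.update p i q) - F (V
    n) p| ≤ ε) → (∀ r : ℝ, 0 < r → ∀ᶠ n in Filter.atTop, ∀ (p : Fin k → ℤ × ℤ), Function.Injective p → Adm
    (V n) p → (∀ i', ∃ d : ℤ × ℤ, (d = (1, 0) ∨ d = (-1, 0) ∨ d = (0, 1) ∨ d = (0, -1)) ∧ ∀ v : ℤ × ℤ,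
    (((((v).1 - (p i').1) ^ 2 + ((v).2 - (p i').2) ^ 2 : ℤ) : ℝ)) ≤ (r / δ n) ^ 2 → (v ∈ V n ↔ 0 ≤ (v.1 - (p
    i').1) * d.1 + (v.2 - (p i').2) * d.2)) → (∀ i₁ i₂ : Fin k, i₁ ≠ i₂ → (r / δ n) ^ 2 ≤ ((((((p) i₁).1 -
    ((p) i₂).1) ^ 2 + (((p) i₁).2 - ((p) i₂).2) ^ 2 : ℤ) : ℝ))) → 0 < P (V n) p) → (∀ r : ℝ, 0 < r → r ≤ r₀
    → ∀ ρ : ℝ, 0 < ρ → ρ ≤ r → ∀ᶠ n in Filter.atTop, ∀ x : Fin k → ℤ, StrictMono x → (∀ i₁ i₂ : Fin k, i₁ ≠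
    i₂ → (r / δ n) ^ 2 ≤ (((x i₁ - x i₂) ^ 2 : ℤ) : ℝ)) → (∀ i, (((x i) ^ 2 : ℤ) : ℝ) ≤ (s₀ / δ n) ^ 2) → ∃
    (T : ℕ) (q : ℕ → Fin k → ℤ × ℤ) (σ : ℕ → Bool), q 0 = p n ∧ (q T = fun i ↦ ((a n).1 + x i, (a n).2)) ∧
    (T : ℝ) * δ n ≤ N ∧ ((Finset.range T).filter (fun t ↦ σ t = false)).card ≤ N ∧ (∀ t, t ≤ T →
    Function.Injective (q t) ∧ Adm (V n) (q t) ∧ (∀ i, ∃ d : ℤ × ℤ, (d = (1, 0) ∨ d = (-1, 0) ∨ d = (0, 1) ∨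
    d = (0, -1)) ∧ ∀ v : ℤ × ℤ, (((((v).1 - (q t i).1) ^ 2 + ((v).2 - (q t i).2) ^ 2 : ℤ) : ℝ)) ≤ (ρ / 4 / δ
    n) ^ 2 → (v ∈ V n ↔ 0 ≤ (v.1 - (q t i).1) * d.1 + (v.2 - (q t i).2) * d.2)) ∧ (∀ i₁ i₂ : Fin k, i₁ ≠ i₂
    → (r / δ n) ^ 2 ≤ ((((((q t) i₁).1 - ((q t) i₂).1) ^ 2 + (((q t) i₁).2 - ((q t) i₂).2) ^ 2 : ℤ) : ℝ))))
    ∧ (∀ t, t < T → (σ t = true → ∃ (i : Fin k) (τ : ℤ × ℤ), (τ = (1, 0) ∨ τ = (-1, 0) ∨ τ = (0, 1) ∨ τ =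
    (0, -1)) ∧ q (t + 1) = Function.update (q t) i (q t i + τ)) ∧ (σ t = false → ∃ (i : Fin k) (q' : ℤ × ℤ),
    q (t + 1) = Function.update (q t) i q' ∧ (∀ i', i' ≠ i → ∃ d : ℤ × ℤ, (d = (1, 0) ∨ d = (-1, 0) ∨ d =
    (0, 1) ∨ d = (0, -1)) ∧ ∀ v : ℤ × ℤ, (((((v).1 - (q t i').1) ^ 2 + ((v).2 - (q t i').2) ^ 2 : ℤ) : ℝ)) ≤
    (r / δ n) ^ 2 → (v ∈ V n ↔ 0 ≤ (v.1 - (q t i').1) * d.1 + (v.2 - (q t i').2) * d.2)) ∧ (((((q').1 - (q t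
    i).1) ^ 2 + ((q').2 - (q t i).2) ^ 2 : ℤ) : ℝ)) ≤ (ρ / δ n) ^ 2))) → ∀ ε : ℝ, 0 < ε → ∀ r : ℝ, 0 < r → r
    ≤ r₀ → ∀ᶠ n in Filter.atTop, ∀ x : Fin k → ℤ, StrictMono x → (∀ i₁ i₂ : Fin k, i₁ ≠ i₂ → (r / δ n) ^ 2 ≤
    (((x i₁ - x i₂) ^ 2 : ℤ) : ℝ)) → (∀ i, (((x i) ^ 2 : ℤ) : ℝ) ≤ (s₀ / δ n) ^ 2) → Adm (V n) (fun i ↦ ((a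
    n).1 + x i, (a n).2)) ∧ 0 < P (V n) (p n) ∧ 0 < P (V n) (fun i ↦ ((a n).1 + x i, (a n).2)) ∧ |F (V n) (p
    n) - F (V n) (fun i ↦ ((a n).1 + x i, (a n).2))| ≤ ε := by
  intro k Adm P F δ hδ V p a s₀ r₀ N hPTa hPTb hR hT ε hε r hr hrr₀
  set ε' : ℝ := ε / (2 * N + 2) with hε'
  have hε'pos : 0 < ε' := by positivity
  obtain ⟨ρ, hρ, hρr, hB⟩ := hPTb r ε' hr hε'pos
  have hρ4 : 0 < ρ / 4 := by positivity
  have hA := hPTa (ρ / 4) ε' hρ4 hε'pos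
  have hRe := hR (ρ / 4) hρ4
  have hTr := hT r hr hrr₀ ρ hρ hρr
  filter_upwards [hA, hB, hRe, hTr] with n hAn hBn hRn hTn
  intro x hx hgap hbd
  obtain ⟨T, q, σ, hq0, hqT, hTδ, hcard, hconf, hstep⟩ := hTn x hx hgap hbd
  have hδn := hδ n
  have hsepmono : (ρ / 4 / δ n) ^ 2 ≤ (r / δ n) ^ 2 := by
    apply pow_le_pow_left₀ (by positivity)
    exact div_le_div_of_nonneg_right (by linarith) hδn.le
  have hpos : ∀ t, t ≤ T → 0 < P (V n) (q t) := by
    intro t ht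
    obtain ⟨hinj, hadm, hfl, hsp⟩ := hconf t ht
    exact hRn (q t) hinj hadm hfl (fun i₁ i₂ hne ↦ hsepmono.trans (hsp i₁ i₂ hne))
  have hsteps : ∀ t, t < T →
      |F (V n) (q (t + 1)) - F (V n) (q t)| ≤ if σ t then ε' * δ n else ε' := by
    intro t ht
    obtain ⟨hinj, hadm, hfl, hsp⟩ := hconf t ht.le
    obtain ⟨hinj', hadm', hfl', hsp'⟩ := hconf (t + 1) ht
    have hp := hpos t ht.le
    have hp' := hpos (t + 1) ht
    obtain ⟨hsl, hju⟩ := hstep t ht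
    cases hσ : σ t with
    | true =>
      obtain ⟨i, τ, hτ, hupd⟩ := hsl hσ
      simp only [if_true]
      rw [hupd] at hinj' hadm' hp' ⊢
      exact hAn (q t) i τ hτ hinj hinj' hadm hadm' hp hp' hfl
        (fun i₁ i₂ hne ↦ hsepmono.trans (hsp i₁ i₂ hne))
    | false =>
      obtain ⟨i, q', hupd, hflr, hdist⟩ := hju hσ
      simp only [Bool.false_eq_true, if_false]
      have hflq := hfl' i
      rw [hupd, Function.update_self] at hflq
      rw [hupd] at hinj' hadm' hp' hsp' ⊢
      exact hBn (q t) i q' hinj hinj' hadm hadm' hp hp' hflr (hfl i) hflq hsp hsp' hdist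
  have htel := s3_telescope (F (V n)) q σ (ε' * δ n) ε' (by positivity) T hsteps
  rw [hq0, hqT] at htel
  have hadmT := (hconf T le_rfl).2.1
  have hposT := hpos T le_rfl
  have hpos0 := hpos 0 (Nat.zero_le T)
  rw [hqT] at hadmT hposT
  rw [hq0] at hpos0
  refine ⟨hadmT, hpos0, hposT, ?_⟩
  rw [abs_sub_comm]
  have hcardR : ((((Finset.range T).filter (fun t ↦ σ t = false)).card : ℕ) : ℝ) ≤ N := by
    exact_mod_cast hcard
  have hfrac : (2 * N : ℝ) / (2 * N + 2) ≤ 1 := by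
    rw [div_le_one (by positivity)]
    linarith
  calc |F (V n) (fun i ↦ ((a n).1 + x i, (a n).2)) - F (V n) (p n)|
      ≤ (T : ℝ) * (ε' * δ n) +
        ((((Finset.range T).filter (fun t ↦ σ t = false)).card : ℕ) : ℝ) * ε' := htel
    _ = ε' * ((T : ℝ) * δ n) +
        ((((Finset.range T).filter (fun t ↦ σ t = false)).card : ℕ) : ℝ) * ε' := by ring
    _ ≤ ε' * N + N * ε' := by gcongr
    _ = ε * ((2 * N : ℝ) / (2 * N + 2)) := by rw [hε']; ring
    _ ≤ ε * 1 := by gcongr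
    _ = ε := mul_one ε

end Summit.CriticalPhenomena.CardyFormulaZ2.Cruxes.BoundaryDefectGaussianR.RainbowMonomialsInExcursionKernels

end
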